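import Literature.NumberTheory.CubicFields.StabilizerFiniteReducible
import HarnessLib

/-!
# `|Aut(ℤ³)| = 6`: the stabilizer of `uv(u + v)` has exactly six elements (BTT (29), last line)

Topic `Literature/NumberTheory/CubicFields`; built on `StabilizerFiniteReducible.lean` (an element
of `Stab(0, b, c, d)`, `b ≠ 0`, is determined by its first row and determinant; the first-row
constraint `q(bp² + cpq + dq²) = 0`).

Bhargava–Taniguchi–Thorne 2023, §4.1 (29): "`|Aut(F)| = 6` if `F = ℚ × ℚ × ℚ`", i.e. for the
maximal order `ℤ³`, whose form is `f₀ = uv(u + v) = (0, 1, 1, 0)` of discriminant `1`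
(`ReducibleCubicRings`: `R(0,1,c,d) ≅ ℤ × ℤ[t]/(t² + ct + d)`, here `ℤ × ℤ[t]/(t² + t) ≅ ℤ³`). We prove
**`|Stab_{GL₂(ℤ)}(f₀)| = |Aut R(f₀)| = 6`**:

* six explicit elements (`1`, `(1 0; 1 −1)`, `(0 −1; −1 0)`, `(0 −1; 1 −1)`, `(−1 1; 0 1)`,
  `(−1 1; −1 0)` — the signed permutations of the three root lines `u = 0`, `v = 0`, `u + v = 0`);
* `rowDet_mem_of_mem_stabilizer` — conversely the pair (first row, determinant) of an element of
  `Stab(f₀)` is one of six possibilities (`q p (p + q) = 0`, primitivity, and the `u²v`-coefficient),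
  and it determines the element (`eq_of_mem_stabilizer_of_row_eq`);
* **`card_stabilizer_cubeForm`**, **`card_ringAut_cubeForm`** — `= 6`.

## References

* M. Bhargava, T. Taniguchi, F. Thorne, *Improved error estimates for the Davenport–Heilbronn
  theorems*, Math. Ann. 389 (2024) = arXiv:2107.12819, §4.1 (29) [BhargavaTaniguchiThorne2023].
-/

namespace Literature.NumberTheory.CubicFields

open BinaryCubic RingOfForm

/-- The form `f₀ = uv(u + v) = (0, 1, 1, 0)` of `ℤ³` (discriminant `1`). [folklore] -/
def cubeForm : BinaryCubic ℤ := ⟨0, 1, 1, 0⟩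

/-- `Disc f₀ = 1`. [folklore] -/
theorem disc_cubeForm : cubeForm.disc = 1 := by
  rw [cubeForm, disc_eq]; norm_num

/-! ### Six elements of the stabilizer -/

/-- `τ₁ = (0 −1; −1 0)` (swap the lines `u = 0`, `v = 0`, with a sign), an involution. [folklore] -/
def tau1 : GL (Fin 2) ℤ where
  val := !![0, -1; -1, 0]
  inv := !![0, -1; -1, 0]
  val_inv := by ext i j; fin_cases i <;> fin_cases j <;> simp [Matrix.mul_apply, Fin.sum_univ_two]
  inv_val := by ext i j; fin_cases i <;> fin_cases j <;> simp [Matrix.mul_apply, Fin.sum_univ_two]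

/-- `τ₂ = (0 −1; 1 −1)`, of order `3`, with inverse `(−1 1; −1 0)`. [folklore] -/
def tau2 : GL (Fin 2) ℤ where
  val := !![0, -1; 1, -1]
  inv := !![-1, 1; -1, 0]
  val_inv := by ext i j; fin_cases i <;> fin_cases j <;> simp [Matrix.mul_apply, Fin.sum_univ_two]
  inv_val := by ext i j; fin_cases i <;> fin_cases j <;> simp [Matrix.mul_apply, Fin.sum_univ_two]

/-- `τ₃ = (−1 1; 0 1)`, an involution. [folklore] -/
def tau3 : GL (Fin 2) ℤ where
  val := !![-1, 1; 0, 1]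
  inv := !![-1, 1; 0, 1]
  val_inv := by ext i j; fin_cases i <;> fin_cases j <;> simp [Matrix.mul_apply, Fin.sum_univ_two]
  inv_val := by ext i j; fin_cases i <;> fin_cases j <;> simp [Matrix.mul_apply, Fin.sum_univ_two]

/-- `τ₄ = (1 0; 1 −1)`, an involution. [folklore] -/
def tau4 : GL (Fin 2) ℤ where
  val := !![1, 0; 1, -1]
  inv := !![1, 0; 1, -1]
  val_inv := by ext i j; fin_cases i <;> fin_cases j <;> simp [Matrix.mul_apply, Fin.sum_univ_two]
  inv_val := by ext i j; fin_cases i <;> fin_cases j <;> simp [Matrix.mul_apply, Fin.sum_univ_two]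

/-- The six elements, as a function on `Fin 6`. [folklore] -/
def sixElements : Fin 6 → GL (Fin 2) ℤ :=
  ![1, tau4, tau1, tau2, tau3, tau2⁻¹]

/-- Their matrices. [folklore] -/
theorem coe_sixElements (i : Fin 6) : ((sixElements i : GL (Fin 2) ℤ) : Matrix (Fin 2) (Fin 2) ℤ) =
    ![(1 : Matrix (Fin 2) (Fin 2) ℤ), !![1, 0; 1, -1], !![0, -1; -1, 0], !![0, -1; 1, -1], !![-1, 1; 0, 1], !![-1, 1; -1, 0]] i := by
  fin_cases i <;> rfl

/-- **All six stabilize `f₀`.** [folklore] -/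
theorem sixElements_mem (i : Fin 6) : sixElements i ∈ MulAction.stabilizer (GL (Fin 2) ℤ) cubeForm := by
  rw [mem_stabilizer_iff_twist, coe_sixElements]
  fin_cases i <;> (ext <;> simp [cubeForm, twist, subst, Matrix.det_fin_two])

/-- The invariant `(M₀₀, M₀₁, det M)` of a `GL₂(ℤ)` element. [folklore] -/
def rowDet (γ : GL (Fin 2) ℤ) : ℤ × ℤ × ℤ :=
  ((γ : Matrix (Fin 2) (Fin 2) ℤ) 0 0, (γ : Matrix (Fin 2) (Fin 2) ℤ) 0 1, (γ : Matrix (Fin 2) (Fin 2) ℤ).det)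

/-- The six elements have six distinct invariants. [folklore] -/
theorem rowDet_sixElements (i : Fin 6) :
    rowDet (sixElements i) = ![((1 : ℤ), (0 : ℤ), (1 : ℤ)), (1, 0, -1), (0, -1, -1), (0, -1, 1), (-1, 1, -1), (-1, 1, 1)] i := by
  unfold rowDet
  rw [coe_sixElements]
  fin_cases i <;> simp [Matrix.det_fin_two]

/-- Hence the six elements are distinct. [folklore] -/
theorem sixElements_injective : Function.Injective sixElements := by
  intro i j h
  have h' := congrArg rowDet h
  rw [rowDet_sixElements, rowDet_sixElements] at h'
  fin_cases i <;> fin_cases j <;> simp_all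

/-! ### At most six elements -/

/-- The admissible invariants. [folklore] -/
def admissible : Finset (ℤ × ℤ × ℤ) :=
  {(1, 0, 1), (1, 0, -1), (0, -1, -1), (0, -1, 1), (-1, 1, -1), (-1, 1, 1)}

/-- **The invariant of an element of `Stab(f₀)` is admissible**: `q p (p + q) = 0` and `(p, q)`
primitive give six possible first rows, and the `u²v`-coefficient (`= det · (p²s + 2pqr + 2pqs + q²r)`
must be `1`) excludes `(−1, 0)`, `(0, 1)`, `(1, −1)`. [folklore] -/
theorem rowDet_mem_of_mem_stabilizer {γ : GL (Fin 2) ℤ} (hγ : γ ∈ MulAction.stabilizer (GL (Fin 2) ℤ) cubeForm) :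
    rowDet γ ∈ admissible := by
  obtain ⟨hrow, hcop⟩ := row_constraint_of_mem_stabilizer (b := 1) (c := 1) (d := 0) hγ
  have hdetu : IsUnit (γ : Matrix (Fin 2) (Fin 2) ℤ).det := Matrix.isUnits_det_units γ
  rw [Matrix.det_fin_two] at hdetu
  rw [mem_stabilizer_iff_twist] at hγ
  have hb := congrArg BinaryCubic.b hγ
  simp only [cubeForm, twist, subst, smul_b, Matrix.det_fin_two] at hb
  unfold rowDet admissible
  simp only [Finset.mem_insert, Finset.mem_singleton, Prod.mk.injEq, Matrix.det_fin_two]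
  -- abbreviations (introduced last, so that they catch every occurrence)
  set p := (γ : Matrix (Fin 2) (Fin 2) ℤ) 0 0 with hp
  set q := (γ : Matrix (Fin 2) (Fin 2) ℤ) 0 1 with hq
  set r := (γ : Matrix (Fin 2) (Fin 2) ℤ) 1 0 with hr
  set s := (γ : Matrix (Fin 2) (Fin 2) ℤ) 1 1 with hs
  have hdet2 : (p * s - q * r) ^ 2 = 1 := by
    rcases Int.isUnit_iff.mp hdetu with h | h <;> rw [h] <;> norm_num
  -- `q p (p + q) = 0`
  have hrow' : q * p * (p + q) = 0 := by linear_combination hrow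
  rcases mul_eq_zero.mp hrow' with h1 | h1
  · rcases mul_eq_zero.mp h1 with hq0 | hp0
    · -- `q = 0`: `p = ±1`, and the `b`-equation gives `p = 1`
      have hpu : IsUnit p := by rw [hq0] at hcop; exact isCoprime_zero_right.mp hcop
      rw [hq0] at hb hdet2
      have hs2 : s ^ 2 = 1 := by
        rcases Int.isUnit_iff.mp hpu with h | h <;> rw [h] at hdet2 <;> nlinarith [hdet2]
      have hp1 : p = 1 := by
        have e : p ^ 3 * s ^ 2 = 1 := by linear_combination hb
        rcases Int.isUnit_iff.mp hpu with h | h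
        · exact h
        · rw [h, hs2] at e; norm_num at e
      rw [hq0, hp1]
      have : s = 1 ∨ s = -1 := by
        have : (s - 1) * (s + 1) = 0 := by linear_combination hs2
        rcases mul_eq_zero.mp this with h | h
        · left; linarith
        · right; linarith
      omega
    · -- `p = 0`: `q = ±1`, and the `b`-equation gives `q = -1`… precisely `det · q² r = 1` with `det = -q r`
      have hqu : IsUnit q := by rw [hp0] at hcop; exact isCoprime_zero_left.mp hcop
      rw [hp0] at hb hdet2
      have hq2 : q ^ 2 = 1 := by rcases Int.isUnit_iff.mp hqu with h | h <;> rw [h] <;> norm_num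
      have hr2 : r ^ 2 = 1 := by nlinarith [hdet2, hq2]
      -- `hb : (0 * s - q * r) * (q ^ 2 * r) = 1`, i.e. `-q³ r² = 1`, so `q = -1`
      have hq1 : q = -1 := by
        have e : q ^ 3 * r ^ 2 = -1 := by linear_combination -hb
        rcases Int.isUnit_iff.mp hqu with h | h
        · rw [h, hr2] at e; norm_num at e
        · exact h
      rw [hp0, hq1]
      have : r = 1 ∨ r = -1 := by
        have : (r - 1) * (r + 1) = 0 := by linear_combination hr2
        rcases mul_eq_zero.mp this with h | h
        · left; linarith
        · right; linarith
      omega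
  · -- `p = -q`: `q = ±1`; the `b`-equation gives `(p, q) = (-1, 1)`
    have hpq : p = -q := by linarith
    have hqu : IsUnit q := by
      obtain ⟨α, β, hαβ⟩ := hcop
      rw [hpq] at hαβ
      exact IsUnit.of_mul_eq_one (β - α) (by linear_combination hαβ)
    rw [hpq] at hb hdet2
    have hq2 : q ^ 2 = 1 := by rcases Int.isUnit_iff.mp hqu with h | h <;> rw [h] <;> norm_num
    -- `det = -q s - q r = -q (s + r)`, `det² = 1` gives `(s + r)² = 1`
    have hsr2 : (s + r) ^ 2 = 1 := by nlinarith [hdet2, hq2]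
    -- `hb`: `det · (q² s - 2 q² r - 2 q² s + q² r) = det · q² (-(s + r)) = -q (s+r) · (-(s+r)) q² = q³ (s+r)²`
    have hq1 : q = 1 := by
      have e : q ^ 3 * (s + r) ^ 2 = 1 := by linear_combination hb
      rcases Int.isUnit_iff.mp hqu with h | h
      · exact h
      · rw [h, hsr2] at e; norm_num at e
    rw [hpq, hq1]
    have : s + r = 1 ∨ s + r = -1 := by
      have : (s + r - 1) * (s + r + 1) = 0 := by linear_combination hsr2
      rcases mul_eq_zero.mp this with h | h
      · left; linarith
      · right; linarith
    omega

/-- `rowDet` is injective on `Stab(f₀)` (`eq_of_mem_stabilizer_of_row_eq` with `b = 1`). [folklore] -/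
theorem rowDet_injOn_stabilizer {γ γ' : GL (Fin 2) ℤ} (hγ : γ ∈ MulAction.stabilizer (GL (Fin 2) ℤ) cubeForm)
    (hγ' : γ' ∈ MulAction.stabilizer (GL (Fin 2) ℤ) cubeForm) (h : rowDet γ = rowDet γ') : γ = γ' := by
  simp only [rowDet, Prod.mk.injEq] at h
  exact eq_of_mem_stabilizer_of_row_eq (b := 1) (c := 1) (d := 0) one_ne_zero hγ hγ' h.1 h.2.1 h.2.2

/-! ### `|Stab(f₀)| = 6` -/

/-- **`|Stab_{GL₂(ℤ)}(uv(u+v))| = 6`** (BTT (29): `|Aut(ℚ × ℚ × ℚ)| = 6`). [cite: BhargavaTaniguchiThorne2023, §4.1 (29) (|Aut F| = 6 for F = ℚ³)] -/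
theorem card_stabilizer_cubeForm : Nat.card (MulAction.stabilizer (GL (Fin 2) ℤ) cubeForm) = 6 := by
  classical
  haveI : Finite (MulAction.stabilizer (GL (Fin 2) ℤ) cubeForm) :=
    finite_stabilizer_of_disc_ne_zero (by rw [disc_cubeForm]; exact one_ne_zero)
  apply le_antisymm
  · -- injection into the six admissible invariants
    have h := Nat.card_le_card_of_injective
      (fun γ : MulAction.stabilizer (GL (Fin 2) ℤ) cubeForm => (⟨rowDet γ, rowDet_mem_of_mem_stabilizer γ.2⟩ : admissible))
      (fun γ γ' hh => Subtype.ext (rowDet_injOn_stabilizer γ.2 γ'.2 (congrArg Subtype.val hh)))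
    rw [Nat.card_eq_fintype_card (α := admissible), Fintype.card_coe] at h
    exact h.trans (by decide)
  · -- six distinct elements
    have h := Nat.card_le_card_of_injective
      (fun i : Fin 6 => (⟨sixElements i, sixElements_mem i⟩ : MulAction.stabilizer (GL (Fin 2) ℤ) cubeForm))
      (fun i j hh => sixElements_injective (congrArg Subtype.val hh))
    rwa [Nat.card_eq_fintype_card, Fintype.card_fin] at h

/-- **`|Aut R(uv(u+v))| = |Aut(ℤ × ℤ[t]/(t² + t))| = |Aut ℤ³| = 6`** (Levi–Delone–Faddeev `Stab ≅ Aut`). [cite: BhargavaTaniguchiThorne2023, §4.1 (29) (|Aut(ℤ³)| = 6)] -/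
theorem card_ringAut_cubeForm : Nat.card (RingAut (RingOfForm cubeForm)) = 6 := by
  rw [← card_stabilizer_eq_card_ringAut, card_stabilizer_cubeForm]

end Literature.NumberTheory.CubicFields
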